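import Summits.QuantumFields.YangMills.Theorems.UnitScaleTiltProp7SectET3PropagatorsReality
import Summits.QuantumFields.YangMills.Theorems.UnitScaleTiltProp7SectET3HilbertLettersT3Reality
import HarnessLib

/-!
# Route `UnitScaleTilt`, crux K1 child «MinimiserStabilityRegPr» (stmt-QuantumFields-19200), skeleton v10, stub `stub_existenceMinimalOrbit` (EX),
# route (α) — **PRINT'S `H(U₀)` OF `h46tw` (AND `H₁(U₀)` OF `hH₁R`) COMMUTES WITH `X ↦ Xᴴ`: IT MAPS (SKEW-)HERMITIAN BLOCK DATA TO (SKEW-)HERMITIAN FIELDS**, at every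
# `SU(2)` background, given the two displayed data rows «`QTwS U₀ (Aᴴ) = (QTwS U₀ A)ᴴ`» ((Q-a) ✓`Prop7QTwSReality` ⊕ (Q-b)) and «`Δ^η_{U₀}` real»

Cell `ym3-torus`, width seat `ym-ust-20520-w4` (gen 4).  THEOREMS ONLY (0 `def`, 0 `sorry`).  Part (a), part 2 of the ym-inputs-p03 g2 ∕ ★w4-20520 g4 split (bus 2026-08-28
10:44Z ∕ 10:54Z): the abstract assembly ✓`Prop7SectET3PropagatorsReality.HT_comm`∕`Hf_comm`∕`H46_comm` INSTANTIATED at p03's concrete anti-unitary conjugation triple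
(`Prop7SectET3HilbertLettersReality`: `σ := toL2∘star∘toL2⁻¹` etc., `inner_toL2_star`∕`toL2_star_star`∕`toL2_star_add`∕`toL2_star_smul_real` and the site∕block twins, the data row
`DL2_star_comm`, and `QL2_star_comm_of` from the displayed `QTwS` row).  Nothing here closes the stub; `--supports stmt-QuantumFields-19200 --as helper`, count-neutral.  YM₃ on T³ is a
ladder rung (R3), not the Clay problem; nothing here claims the stub, the crux, d = 4 or the gap.

THE PRINT.  [Balaban1985BackgroundPropagators] p. 393 «The operators … are real»; (3.126) `H = GQ*(QGQ*)⁻¹`; [Balaban1985Variational] (45)–(46) p. 285, (51) p. 286 «for A′ with values in 𝔤 the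
configuration … has values in 𝔤 also».

WHAT IS PROVED (sorry-free, no definition), for every slot `Δx` resp. the slot of record `Δ_π`, under the displayed rows `hQ : ∀ A, QTwS U₀ (star A) = star (QTwS U₀ A)` and
`hΔx`∕`hΔη : Δx U₀ ∘ σ = σ ∘ Δx U₀` (σ = p03's conjugation of `BondL2K`):
★`HT_star_comm` (Hilbert level), ★★`Hf_star_comm : Hf … Δx U₀ (star Y) = star (Hf … Δx U₀ Y)`, ★★`H1f_star_comm` (the `hH₁R` letter, read through `JetSup.equiv`),
★★★`H46_star_comm : H46 … U₀ (star Y) = star (H46 … U₀ Y)`, and the knit's halves ★★★`star_H46_eq_neg_of_skew` («skew-Hermitian data ↦ skew-Hermitian field», the `star` half of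
`h46tw`.(R-H)) ∕ `star_Hf_eq_neg_of_skew` ∕ `H1f_isHermitian_of_isHermitian` (the `IsHermitian` half of `hH₁R`).  The TRACE halves (traceless ↦ traceless) need the sector rows of
`QTwS` ((Q-a) gives the traceless sector, (Q-b) the scalar one) and are NOT in this file.

References: T. Bałaban, CMP 99 (1985) 389–434 [Balaban1985BackgroundPropagators] (p.393, (3.126) p.420); CMP 102 (1985) 277–309 [Balaban1985Variational] ((45)–(46) p.285, (51) p.286,
(103) p.293).
-/

set_option autoImplicit false

noncomputable section

open scoped InnerProductSpace ComplexConjugate Matrix.Norms.L2Operator BigOperators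

namespace Summit.QuantumFields.YangMills.Theorems.Prop7H46Reality

open Literature.MathematicalPhysics.QuantumFieldTheory.Balaban1983to89
open Literature.MathematicalPhysics.QuantumFieldTheory.Balaban1983to89.T3ContinuumYM3Torus
open T3SectALandauChart (eta)
open B9SectCLatticeCarrier (Bond)
open B9Eq311L2Pairing (WL2)
open B11Eq103H1Complex (SiteL2K BondL2K)
open B11Eq115Space (JetSup)
open Summit.QuantumFields.YangMills.Theorems.Prop7SectET3Transport (periodsT3 bondEquiv)
open Summit.QuantumFields.YangMills.Theorems.Prop7SectET3HilbertLetters (W₂ frobEquiv toL2 toL2S toL2B QL2 DL2 toL2_apply toL2_symm_apply)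
open Summit.QuantumFields.YangMills.Theorems.Prop7SectET3CurvedPropagators (HT Hf H1f H1f_apply)
open Summit.QuantumFields.YangMills.Theorems.Prop7SectET3WilsonHessian (DeltaEta)
open Summit.QuantumFields.YangMills.Theorems.Prop7SectET3DeltaPi (DeltaPiSlot H46)
open Summit.QuantumFields.YangMills.Theorems.Prop7SymAvgTwSym (QTwS)
open Summit.QuantumFields.YangMills.Theorems.Prop7SectET3PropagatorsReality (HT_comm Hf_comm DeltaPi_comm)
open Summit.QuantumFields.YangMills.Theorems.Prop7SectET3HilbertLettersReality (toL2_star_star toL2_star_add toL2_star_smul_real inner_toL2_star toL2S_star_star toL2S_star_add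
  toL2S_star_smul_real inner_toL2S_star toL2B_star_star toL2B_star_add toL2B_star_smul_real inner_toL2B_star DL2_star_comm QL2_star_comm_of)

variable (F : T3Family) (n K : ℕ) (h : n ≤ K) (c₀ cB a : ℝ) [Fact (0 < c₀)] [Fact (0 < cB)]

/-! ## §1 At an arbitrary slot `Δx`: `H`, `Hf`, `H₁f` commute with `X ↦ Xᴴ` -/

section Slot

variable (Δx : GaugeField (F.P K) 0 (Matrix.specialUnitaryGroup (Fin 2) ℂ) → (BondL2K ℂ 3 (periodsT3 F K) c₀ W₂ →ₗ[ℂ] BondL2K ℂ 3 (periodsT3 F K) c₀ W₂))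
  (U₀ : GaugeField (F.P K) 0 (Matrix.specialUnitaryGroup (Fin 2) ℂ))
  (hQ : ∀ A : PBond (F.P K) 0 → Matrix (Fin 2) (Fin 2) ℂ, QTwS F n K h U₀ (star A) = star (QTwS F n K h U₀ A))
  (hΔx : ∀ f : BondL2K ℂ 3 (periodsT3 F K) c₀ W₂, Δx U₀ (toL2 F K c₀ (star ((toL2 F K c₀).symm f))) = toL2 F K c₀ (star ((toL2 F K c₀).symm (Δx U₀ f))))

include hQ hΔx in
/-- ★ **`H(U₀) = GQ*(QGQ*)⁻¹` AT THE SLOT `Δx` COMMUTES WITH THE CONJUGATION** (Hilbert level): ✓`HT_comm` at p03's anti-unitary triple, the data rows `DL2_star_comm`, `QL2_star_comm_of hQ`, `hΔx`.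
[cite: Balaban1985BackgroundPropagators, (3.126) p.420, p.393; Balaban1985Variational, (51) p.286] -/
theorem HT_star_comm (y : WL2 ℂ (fun _ : PBond (F.P n) 0 => cB) W₂) :
    HT F n K h c₀ cB a Δx U₀ (toL2B F n cB (star ((toL2B F n cB).symm y))) = toL2 F K c₀ (star ((toL2 F K c₀).symm (HT F n K h c₀ cB a Δx U₀ y))) :=
  HT_comm F n K h c₀ cB a U₀ (fun f => toL2 F K c₀ (star ((toL2 F K c₀).symm f))) (fun g => toL2S F K c₀ (star ((toL2S F K c₀).symm g)))
    (fun y => toL2B F n cB (star ((toL2B F n cB).symm y))) Δx (Or.inl ⟨inner_toL2_star, inner_toL2S_star, inner_toL2B_star⟩)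
    toL2_star_add toL2S_star_add toL2B_star_add toL2_star_star toL2S_star_star toL2B_star_star toL2B_star_smul_real (DL2_star_comm U₀) (QL2_star_comm_of U₀ hQ) hΔx y

include hQ hΔx in
/-- ★★ **THE ROUTE-CARRIER LETTER `Hf` COMMUTES WITH `X ↦ Xᴴ`**: `Hf … Δx U₀ (Yᴴ) = (Hf … Δx U₀ Y)ᴴ` (pointwise conjugate transpose of functions).
[cite: Balaban1985Variational, (45)–(46) p.285, (51) p.286] -/
theorem Hf_star_comm (Y : PBond (F.P n) 0 → Matrix (Fin 2) (Fin 2) ℂ) : Hf F n K h c₀ cB a Δx U₀ (star Y) = star (Hf F n K h c₀ cB a Δx U₀ Y) := by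
  have key := Hf_comm F n K h c₀ cB a U₀ (fun f => toL2 F K c₀ (star ((toL2 F K c₀).symm f))) (fun g => toL2S F K c₀ (star ((toL2S F K c₀).symm g)))
    (fun y => toL2B F n cB (star ((toL2B F n cB).symm y))) Δx (Or.inl ⟨inner_toL2_star, inner_toL2S_star, inner_toL2B_star⟩)
    toL2_star_add toL2S_star_add toL2B_star_add toL2_star_star toL2S_star_star toL2B_star_star toL2_star_smul_real toL2B_star_smul_real (DL2_star_comm U₀)
    (QL2_star_comm_of U₀ hQ) hΔx Y
  simpa only [LinearEquiv.symm_apply_apply] using key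

include hQ hΔx in
/-- ★★ **THE `hH₁R` LETTER `H₁f` COMMUTES WITH `X ↦ Xᴴ`** (read through `JetSup.equiv` at lit-balaban's bonds, as the knit reads it): `(H₁f (Bᴴ))(x) = ((H₁f B)(x))ᴴ`.
[cite: Balaban1985Variational, (103) p.293, (51) p.286] -/
theorem H1f_star_comm [Fact (0 < (F.L : ℝ))] [Fact (0 < ((F.L : ℝ)⁻¹) ^ (K - n))] (B : PBond (F.P n) 0 → Matrix (Fin 2) (Fin 2) ℂ) (x : Bond 3 (periodsT3 F K)) :
    JetSup.equiv _ _ _ (H1f F n K h c₀ cB a Δx U₀ (star B)) x = star (JetSup.equiv _ _ _ (H1f F n K h c₀ cB a Δx U₀ B) x) := by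
  have key := HT_star_comm F n K h c₀ cB a Δx U₀ hQ hΔx (toL2B F n cB B)
  rw [LinearEquiv.symm_apply_apply] at key
  rw [H1f_apply, H1f_apply, key, toL2_apply, LinearEquiv.apply_symm_apply, Pi.star_apply, toL2_symm_apply, Equiv.apply_symm_apply]

include hQ hΔx in
/-- ★★ **SKEW-HERMITIAN DATA GIVE A SKEW-HERMITIAN `Hf`-FIELD**: `Yᴴ = −Y ⟹ (Hf Y)(b)ᴴ = −(Hf Y)(b)`. [cite: Balaban1985Variational, (51) p.286] -/
theorem star_Hf_eq_neg_of_skew (Y : PBond (F.P n) 0 → Matrix (Fin 2) (Fin 2) ℂ) (hY : ∀ c, star (Y c) = -Y c) (b : PBond (F.P K) 0) :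
    star (Hf F n K h c₀ cB a Δx U₀ Y b) = -Hf F n K h c₀ cB a Δx U₀ Y b := by
  have hY' : star Y = -Y := funext fun c => by rw [Pi.star_apply, Pi.neg_apply, hY c]
  have key := Hf_star_comm F n K h c₀ cB a Δx U₀ hQ hΔx Y
  rw [hY', map_neg] at key
  have hb := congrFun key b
  rw [Pi.neg_apply, Pi.star_apply] at hb
  exact hb.symm

include hQ hΔx in
/-- ★★ **HERMITIAN DATA GIVE A HERMITIAN `H₁f`-FIELD** (the `IsHermitian` half of the knit's `hH₁R`): `B(c)` Hermitian for all `c` ⟹ `(H₁f B)(x)` Hermitian for all `x`.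
[cite: Balaban1985Variational, (103) p.293, (51) p.286] -/
theorem H1f_isHermitian_of_isHermitian [Fact (0 < (F.L : ℝ))] [Fact (0 < ((F.L : ℝ)⁻¹) ^ (K - n))] (B : PBond (F.P n) 0 → Matrix (Fin 2) (Fin 2) ℂ)
    (hB : ∀ c, (B c).IsHermitian) (x : Bond 3 (periodsT3 F K)) : (JetSup.equiv _ _ _ (H1f F n K h c₀ cB a Δx U₀ B) x).IsHermitian := by
  have hB' : star B = B := funext fun c => by rw [Pi.star_apply, Matrix.star_eq_conjTranspose, (hB c).eq]
  have key := H1f_star_comm F n K h c₀ cB a Δx U₀ hQ hΔx B x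
  rw [hB'] at key
  rw [Matrix.IsHermitian, ← Matrix.star_eq_conjTranspose]
  exact key.symm

end Slot

/-! ## §2 At the slot of record `Δ_π`: the `h46tw` letter `H46 U₀` -/

section Record

variable (U₀ : GaugeField (F.P K) 0 (Matrix.specialUnitaryGroup (Fin 2) ℂ))
  (hQ : ∀ A : PBond (F.P K) 0 → Matrix (Fin 2) (Fin 2) ℂ, QTwS F n K h U₀ (star A) = star (QTwS F n K h U₀ A))
  (hΔη : ∀ f : BondL2K ℂ 3 (periodsT3 F K) c₀ W₂, DeltaEta F n K c₀ U₀ (toL2 F K c₀ (star ((toL2 F K c₀).symm f))) = toL2 F K c₀ (star ((toL2 F K c₀).symm (DeltaEta F n K c₀ U₀ f))))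

include hQ hΔη in
/-- **`Δ_π` commutes with the conjugation when `Δ^η_{U₀}` does** (✓`DeltaPi_comm` at p03's triple). [cite: Balaban1985BackgroundPropagators, (3.119) p.419] -/
theorem DeltaPiSlot_star_comm (f : BondL2K ℂ 3 (periodsT3 F K) c₀ W₂) :
    DeltaPiSlot F n K h c₀ cB a U₀ (toL2 F K c₀ (star ((toL2 F K c₀).symm f))) = toL2 F K c₀ (star ((toL2 F K c₀).symm (DeltaPiSlot F n K h c₀ cB a U₀ f))) :=
  DeltaPi_comm F n K h c₀ cB a U₀ (fun f => toL2 F K c₀ (star ((toL2 F K c₀).symm f))) (fun g => toL2S F K c₀ (star ((toL2S F K c₀).symm g)))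
    (fun y => toL2B F n cB (star ((toL2B F n cB).symm y))) (Or.inl ⟨inner_toL2_star, inner_toL2S_star, inner_toL2B_star⟩)
    toL2_star_add toL2S_star_add toL2B_star_add toL2_star_star toL2S_star_star toL2B_star_star toL2S_star_smul_real (DL2_star_comm U₀) (QL2_star_comm_of U₀ hQ) hΔη f

include hQ hΔη in
/-- ★★★ **PRINT'S `H(U₀)` OF `h46tw` COMMUTES WITH `X ↦ Xᴴ`**: `H46 U₀ (Yᴴ) = (H46 U₀ Y)ᴴ`, given only the displayed `QTwS` row `hQ` and the `Δ^η` row `hΔη`.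
[cite: Balaban1985Variational, (45)–(46) p.285, (51) p.286; Balaban1985BackgroundPropagators, (3.126) p.420, p.393] -/
theorem H46_star_comm (Y : PBond (F.P n) 0 → Matrix (Fin 2) (Fin 2) ℂ) : H46 F n K h c₀ cB a U₀ (star Y) = star (H46 F n K h c₀ cB a U₀ Y) :=
  Hf_star_comm F n K h c₀ cB a (DeltaPiSlot F n K h c₀ cB a) U₀ hQ (DeltaPiSlot_star_comm F n K h c₀ cB a U₀ hQ hΔη) Y

include hQ hΔη in
/-- ★★★ **THE `star` HALF OF THE KNIT'S (R-H) CLAUSE FOR `H := H46 U₀`**: skew-Hermitian block data `Y` (`Y(c)ᴴ = −Y(c)`) give a skew-Hermitian field, `(H46 U₀ Y)(b)ᴴ = −(H46 U₀ Y)(b)`.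
[cite: Balaban1985Variational, (45)–(46) p.285, (51) p.286] -/
theorem star_H46_eq_neg_of_skew (Y : PBond (F.P n) 0 → Matrix (Fin 2) (Fin 2) ℂ) (hY : ∀ c, star (Y c) = -Y c) (b : PBond (F.P K) 0) :
    star (H46 F n K h c₀ cB a U₀ Y b) = -H46 F n K h c₀ cB a U₀ Y b :=
  star_Hf_eq_neg_of_skew F n K h c₀ cB a (DeltaPiSlot F n K h c₀ cB a) U₀ hQ (DeltaPiSlot_star_comm F n K h c₀ cB a U₀ hQ hΔη) Y hY b

end Record

end Summit.QuantumFields.YangMills.Theorems.Prop7H46Reality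

end
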